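import Literature.MathematicalPhysics.QuantumFieldTheory.Balaban1983to89.B7Prop4Flat
import HarnessLib

/-!
# Line H (`BirthV10.stub_halvingStep`, stmt-QuantumFields-19200) — LEMMA B-al, brick (F2): ★★ A BLOCK-AXIAL FIELD's SINGLE-BAR COMB AVERAGE IS ITS DOUBLE-BAR
# AVERAGE (`vframe = 1`, `dbavg = bavg`, and `avgIter = dbavgIter` along a block-axial tower)

Cell `ym3-torus` (HUMAN RULING D-0037: YM₃ on T³ is ladder rung R3 — NOT d = 4, NOT infinite volume, NOT a mass gap, NOT the Clay problem), width seat `ym-ust-19200-w3` gen 10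
(LEAD-H ★w5-19200 g7 WORD 10 (2): LEMMA B-al ≡ (N1), analysis pen; SIGNATURE memo `SIGNATURE-LEMMA-B-al-w3g10.md` §1 (F2), §3 (2)).  `--supports stmt-QuantumFields-19200
--as helper`; THEOREMS ONLY (0 `def`, 0 `sorry`); count-neutral; nothing here claims B-al, the collar socket `H42topCrossT`, (M2′), the stub, the crux or the gap.

WHY.  J3's pre-gauged field `U′ = pull (U^{gJ})♯ 0` is BLOCK-AXIAL at every level (J3 (b) = ✓`P1FlatCorePreGauge.exists_preGauge_flat` conjunct 3, [Balaban1985RegularSpaces]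
(1.15)∕(1.19)): the comb tree of every block of the averaged field `avgIter L U′ j` is trivial.  Then the block frame `v(q) = exp[mean_r log Ū(Γ_{q,q+r})]` of
[Balaban1985Averaging] (110)∕(89) is `1`, so the SINGLE-bar average (42) `bavg` (the object of `avgIter`, of (R3) and of ✓p689074's Stokes) IS the DOUBLE-bar average (89)
`dbavg` — the object of (121)∕(127) (`Qcov`, `logIter`) and of [Balaban1985Averaging] Prop. 4 (lit ✓`B7Prop4Flat.prop4_flat`), whose first order is the PLAIN block-straight mean
(no comb-leg functional): this is what lets LEMMA B-al compare the comb tower with the torus double-bar tower `dbarIterU` at second order (px3 g4 (V4); memo (F1)).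
* §1 `Favg_eq_zero_of_blockAxial`, ★ `vframe_eq_one_of_blockAxial` — the frame of a block with trivial comb tree is `1`;
* §2 ★ `dbavg_eq_bavg_of_blockAxial` — (89) = (42) at a bond whose two end-blocks have trivial comb trees;
* §3 ★★ `dbavgIter_eq_avgIter_of_blockAxial` — along a tower that is block-axial at every level `j < k` (J3 (b)'s shape, `axialFn (avgIter L V j) (L•z) (L•z + boxVec L r) = 1`),
  `dbavgIter L V j = avgIter L V j` for all `j ≤ k`; §4 the member's reading `dbavgIter_eq_avgIter_of_J3b` in J3 (b)'s own indexing `K − n − (m+1)`.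
HONEST SCOPE.  Definitional bookkeeping over lit `B7Prop3Flat`∕`B7Prop4Flat`∕`B7Prop2Explicit`; no estimate; nothing of B-al's analytic parts (one-step comparison, induction) is here.

References: T. Bałaban, CMP **98** (1985) 17–51 [Balaban1985Averaging] ((42)–(43) pp.23–24, (89)–(91) p.31, (110) p.34, (127) p.37); CMP **99** (1985) 75–102
[Balaban1985RegularSpaces] ((1.15) p.78, (1.19) p.79).
-/

set_option autoImplicit false

noncomputable section

open scoped BigOperators

namespace Summit.QuantumFields.YangMills.Theorems.HalvingBlockAxialDoubleBar

open Literature.MathematicalPhysics.QuantumFieldTheory.Balaban1983to89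
open B7Prop1Explicit (Site e hol treeWord boxVec axialFn bavg expUnit)
open B7Prop2Explicit (avgIter rescale rescale_apply avgIter_succ)
open B7Prop3Flat (Favg vframe dbavg)
open B7Prop4Flat (dbavgIter dbavgIter_succ)
open MatrixLog (mlog mlog_one)

variable {d : ℕ} {𝔸 : Type*} [NormedRing 𝔸] [NormedAlgebra ℂ 𝔸] [CompleteSpace 𝔸]

/-! ## §1 The frame of a block with trivial comb tree -/

omit [CompleteSpace 𝔸] in
/-- The exponent (110) `F(q) = Σ_r L^{−d} log Ū(Γ_{q,q+r})` vanishes when the block's comb transporters are trivial. [cite: Balaban1985Averaging, (110) p.34] -/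
theorem Favg_eq_zero_of_blockAxial (L : ℕ) (V : Site d → Fin d → 𝔸ˣ) (q : Site d)
    (h : ∀ r : Fin d → Fin L, hol V q (treeWord (boxVec L r)) = 1) : Favg L V q = 0 := by
  unfold Favg
  refine Finset.sum_eq_zero fun r _ => ?_
  rw [h r, Units.val_one, mlog_one, smul_zero]

/-- ★ **The block frame of a block-axial block is trivial**: `v(q) = exp F(q) = 1`. [cite: Balaban1985Averaging, (110) p.34, (89) p.31] -/
theorem vframe_eq_one_of_blockAxial (L : ℕ) (V : Site d → Fin d → 𝔸ˣ) (q : Site d)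
    (h : ∀ r : Fin d → Fin L, hol V q (treeWord (boxVec L r)) = 1) : vframe L V q = 1 := by
  apply Units.ext
  rw [vframe, B7Prop1Explicit.val_expUnit, Favg_eq_zero_of_blockAxial L V q h, NormedSpace.exp_zero, Units.val_one]

/-! ## §2 Double bar = single bar at a bond with block-axial end-blocks -/

/-- ★ **(89) = (42) for block-axial end-blocks**: `V̿(c) = v(c₋)⁻¹·V̄(c)·v(c₊) = V̄(c)` when both frames are `1`. [cite: Balaban1985Averaging, (89) p.31, (42) p.23] -/
theorem dbavg_eq_bavg_of_blockAxial (L : ℕ) (V : Site d → Fin d → 𝔸ˣ) (q : Site d) (κ : Fin d)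
    (hsrc : ∀ r : Fin d → Fin L, hol V q (treeWord (boxVec L r)) = 1)
    (htgt : ∀ r : Fin d → Fin L, hol V (q + (L : ℤ) • e κ) (treeWord (boxVec L r)) = 1) :
    dbavg L V q κ = bavg L V q κ := by
  rw [dbavg, vframe_eq_one_of_blockAxial L V q hsrc, vframe_eq_one_of_blockAxial L V _ htgt, inv_one, one_mul, mul_one]

omit [NormedAlgebra ℂ 𝔸] [CompleteSpace 𝔸] in
/-- The block-axiality hypothesis in J3's letters (`axialFn W (L•z) (L•z + boxVec L r) = 1`) is the triviality of the comb transporters used by the frame.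
[cite: Balaban1985RegularSpaces, (1.15) p.78; Balaban1985Averaging, p.24] -/
theorem hol_treeWord_boxVec_eq_one_of_axialFn (L : ℕ) (W : Site d → Fin d → 𝔸ˣ) (z : Site d)
    (h : ∀ r : Fin d → Fin L, axialFn W ((L : ℤ) • z) ((L : ℤ) • z + boxVec L r) = 1) :
    ∀ r : Fin d → Fin L, hol W ((L : ℤ) • z) (treeWord (boxVec L r)) = 1 := fun r => by
  have hr := h r
  rwa [axialFn, add_sub_cancel_left] at hr

/-! ## §3 The towers coincide along a block-axial tower -/

/-- ★★ **`dbavgIter = avgIter` ALONG A BLOCK-AXIAL TOWER**: if at every level `j < k` every block of the `j`-fold comb average has trivial comb tree, then the double-bar tower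
(90)∕(91) and the single-bar tower (43) agree at every level `j ≤ k`. [cite: Balaban1985Averaging, (43) p.24, (90)-(91) p.31] -/
theorem dbavgIter_eq_avgIter_of_blockAxial (L : ℕ) (V : Site d → Fin d → 𝔸ˣ) (k : ℕ)
    (hax : ∀ j, j < k → ∀ (z : Site d) (r : Fin d → Fin L), axialFn (avgIter L V j) ((L : ℤ) • z) ((L : ℤ) • z + boxVec L r) = 1) :
    ∀ j, j ≤ k → dbavgIter L V j = avgIter L V j
  | 0, _ => rfl
  | j + 1, hj => by
    have ih := dbavgIter_eq_avgIter_of_blockAxial L V k hax j (Nat.le_of_succ_le hj)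
    funext z κ
    rw [dbavgIter_succ, ih, avgIter_succ, rescale_apply]
    have hjk : j < k := hj
    have htgt := hol_treeWord_boxVec_eq_one_of_axialFn L _ (z + e κ) (hax j hjk (z + e κ))
    rw [smul_add] at htgt
    exact dbavg_eq_bavg_of_blockAxial L (avgIter L V j) _ κ (hol_treeWord_boxVec_eq_one_of_axialFn L _ z (hax j hjk z)) htgt

/-! ## §4 The member's reading (J3 (b)'s indexing) -/

/-- **The same in J3 (b)'s indexing** (`✓exists_preGauge_flat` conjunct 3: `∀ m < k, axialFn (avgIter L U′ (k − (m+1))) (L•z) (L•z + boxVec L r) = 1`): the comb tower of the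
pre-gauged field IS its double-bar tower up to the top, `dbavgIter L U′ k = avgIter L U′ k` (and at every lower level). [cite: Balaban1985RegularSpaces, (1.15) p.78, (1.19) p.79; Balaban1985Averaging, (90)-(91) p.31] -/
theorem dbavgIter_eq_avgIter_of_J3b (L : ℕ) (U' : Site d → Fin d → 𝔸ˣ) (k : ℕ)
    (hb : ∀ m, m < k → ∀ (z : Site d) (r : Fin d → Fin L), axialFn (avgIter L U' (k - (m + 1))) ((L : ℤ) • z) ((L : ℤ) • z + boxVec L r) = 1) :
    ∀ j, j ≤ k → dbavgIter L U' j = avgIter L U' j :=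
  dbavgIter_eq_avgIter_of_blockAxial L U' k fun j hj z r => by
    have h := hb (k - (j + 1)) (by omega) z r
    rwa [show k - (k - (j + 1) + 1) = j by omega] at h

end Summit.QuantumFields.YangMills.Theorems.HalvingBlockAxialDoubleBar

end
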